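import Literature.MathematicalPhysics.QuantumFieldTheory.Balaban1983to89.BalabanAdmissibleClassParams
import Literature.MathematicalPhysics.QuantumFieldTheory.Balaban1983to89.T3DescentFibreTower
import Literature.MathematicalPhysics.QuantumFieldTheory.Balaban1983to89.B10Eq41TorusHistories
import Literature.MathematicalPhysics.QuantumFieldTheory.Balaban1983to89.T3Thresholds
import HarnessLib

/-!
# Route `BackwardLiouvilleRigidity` — ADMISSIBILITY OF THE SCHEDULE DOES NOT BY ITSELF INHABIT THE CLASS (`exists_admissible_emptyClass`)

Companion (negative side) of `BackwardLiouvilleRigidityAdmFRFrameInhabited` ∕ `…FloorTail` (tribunal J r8 ∕ director-ym R606 ORDER (2),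
crux `BackwardStabilityAdmFR` = stmt-QuantumFields-28294, deliverer `ClassLimitTrajectoriesAdmFR` = stmt-QuantumFields-28295).  Those files
show that along the PRINTED schedule the ∃κ frame is inhabited at every height by the Wilson runs.  This file records the converse caution for
the line-writer of 28295 (which must PRODUCE an admissible schedule): `BalabanUVClass.AdmissibleClassParams` constrains the large-plaquette
threshold only from ABOVE (`δL_j ≤ 2θ_j`), so a schedule with `δL_j := 0` is admissible — and for such a schedule Bałaban's class
`MemAtHeight F ℰp j (prm j)` is EMPTY from a height on, for EVERY density (`1 ≤ p₀`): with `δL ≤ 0` every plaquette is «large», so the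
large-field clause (67)–(71) at `S := univ` caps the density of the TRIVIAL datum by `exp(−cLF_j·#Plaq + c5·#Site)`, while the two-sided
representation (47) with (46)∕(65) bounds it below by `exp(−(Ccov + cE)·#Site − slack)` (the background of the trivial datum has zero action:
`Ū^k(1) = 1`); `#Plaq = 3·#Site` and `cLF_j ≥ ¼p(g_j)² ≥ b₀²(log L)²j²∕16 → ∞` against bounded `Ccov, cE, c5, slack`.

Statements: `iter_blockAvg_one` (`Ū^k(1) = 1` for any small-loop average with `ℰ(1,…,1) = 1`), `Witness.cLF_card_plaq_le` (generic: a
witness with `δL ≤ 0` forces `cLF·#Plaq ≤ (Ccov + cE + c5)·#Site + slack`), `not_memAtHeight_of_δL_nonpos` (admissible + `δL_j ≤ 0` ⇒ empty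
class for `j ≥ j₁`), `exists_admissible_emptyClass` (such an admissible schedule exists).  CONSEQUENCE (bookkeeping, not a defect of 28294):
over such schedules the tower hypotheses of `BackwardStabilityAdmFR` are unsatisfiable from `j₁` on, so 28294 holds there vacuously (harmless,
it is a `∀ prm` statement); 28295 must deliver a non-degenerate schedule — the printed one (`printedSchedule`, `δL_j = 2θ_j`) is the safe currency.

HONEST SCOPE.  Parameter bookkeeping over the typed class; nothing of Bałaban's estimates and nothing of 28294∕28295∕28296 is proved; rung R3
(`YM3TorusSU2`, finite-volume SU(2) YM₃ on T³) and every summit statement stay OPEN; the Yang–Mills mass gap is NOT proved.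
-/

namespace Summit.QuantumFields.YangMills.Theorems.AdmFRFrameEmptyClass

open Filter Topology MeasureTheory
open Literature.MathematicalPhysics.QuantumFieldTheory.Balaban1983to89 T3ContinuumYM3Torus T3UnitLawDensityEML T3UnitScaleTilt BalabanUVClass

/-! ## §1 The trivial configuration is fixed by the block averagings -/

section Trivial

variable {P : Params} {G : Type*} [GaugeGroup G]

/-- **`Ū^k(1) = 1`**: the iterated (0.4) block averaging of the trivial configuration is trivial, for every small-loop average with
`ℰ(1,…,1) = 1` (tree `T3DescentFibreTower.avgFun_one`, iterated). [cite: Balaban1987RG1, (0.4) p.253] -/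
theorem iter_blockAvg_one (ℰ : LoopAverage G) (hE : ∀ n : ℕ, ℰ.E (fun _ : Fin (n + 1) => (1 : G)) = 1) :
    ∀ k : ℕ, Averaging.iter (fun i => BlockAveraging.blockAvg (P := P) (j := i) ℰ) k (1 : GaugeField P 0 G) = 1
  | 0 => rfl
  | k + 1 => by
    show (BlockAveraging.blockAvg (P := P) (j := k) ℰ).avg
      (Averaging.iter (fun i => BlockAveraging.blockAvg (P := P) (j := i) ℰ) k 1) = 1
    rw [iter_blockAvg_one ℰ hE k]
    exact T3DescentFibreTower.avgFun_one _ hE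

end Trivial

/-! ## §2 A witness with a non-positive large threshold pays the large-field exponent on EVERY plaquette -/

section Generic

variable {P : Params} {k : ℕ} {G : Type*} [GaugeGroup G] [MeasurableSpace G]
  {av : (i : ℕ) → Averaging P i G} {prm : ClassParams} {r : GaugeField P k G → ℝ}

/-- **GENERIC OBSTRUCTION**: a `BalabanUVClass.Witness` whose parameters have `0 < δ`, `0 < δreg`, `0 ≤ β` and `δL ≤ 0`, for an averaging family
with `Ū^k(1) = 1`, forces `cLF·#Plaq(T^{(k)}) ≤ (Ccov + cE + c5)·#Site(T^{(k)}) + slack` — the large-field clause at `S := univ` and the datum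
`V := 1` ((67)–(71) p.273: every plaquette is `δL`-large) against the lower representation (47) p.267 with (46)∕(65) at the same datum, whose
background has zero action by minimality over the regular trivial configuration. [cite: Balaban1985UV3, (47) p.267, (65)-(71) p.273] -/
theorem Witness.cLF_card_plaq_le (W : Witness av prm r) (hδ : 0 < prm.δ) (hδreg : 0 < prm.δreg) (hβ : 0 ≤ prm.β)
    (hδL : prm.δL ≤ 0) (h1 : Averaging.iter av k (1 : GaugeField P 0 G) = 1) :
    prm.cLF * Fintype.card (Plaq P k) ≤ (prm.Ccov + prm.cE + prm.c5) * Fintype.card (Site P k) + prm.slack := by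
  classical
  -- the trivial configuration: plaquette variables `1`, in every positive window, zero action (tree twins:
  -- `SubstrateBackgroundDriven.plaqHol_one` ∕ `wilsonAction4_one` in the T⁴ cone, not imported here)
  have hp1 : ∀ {i : ℕ} (p : Plaq P i), GaugeField.plaqHol (1 : GaugeField P i G) p = 1 := fun p => by
    show (1 : G) * 1 * (1 : G)⁻¹ * (1 : G)⁻¹ = 1
    simp
  have hsmall : ∀ {i : ℕ} {δ' : ℝ}, 0 < δ' → PlaqSmall δ' (1 : GaugeField P i G) := fun hδ' p => by
    rw [hp1, GaugeGroup.dist1_one]; exact hδ'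
  have hA1 : wilsonAction4 (1 : GaugeField P 0 G) = 0 := by
    unfold wilsonAction4 wilsonAction
    simp [hp1, GaugeGroup.reTr_one]
  have hV : PlaqSmall prm.δ (1 : GaugeField P k G) := hsmall hδ
  -- the background of the trivial datum has zero action
  have hbg := W.isBackground 1 hV
  have hA0 : wilsonAction4 (W.bg 1) ≤ 0 := by
    have h := hbg.2.2 (1 : GaugeField P 0 G) (hsmall hδreg) h1
    rwa [hA1] at h
  -- lower bound at the trivial datum
  have hlow := W.bounds5_lower 1 hV
  -- upper bound: every plaquette is large
  have hup := W.large 1 Finset.univ (fun p _ => hδL.trans (GaugeGroup.dist1_nonneg _))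
  rw [Finset.card_univ] at hup
  have h := hlow.trans hup
  rw [← Real.exp_add, Real.exp_le_exp] at h
  nlinarith [mul_nonneg hβ (le_refl (0:ℝ)), hA0, hβ, mul_nonpos_iff.mpr (Or.inl ⟨hβ, hA0⟩)]

end Generic

/-! ## §3 Height `j` of the d = 3 family: an admissible schedule with `δL_j ≤ 0` has an empty class from a height on -/

section Height

variable (F : T3Family)

/-- **ADMISSIBLE BUT EMPTY**: for `0 < γ ≤ 1`, `0 < b₀`, `1 ≤ p₀` and an ADMISSIBLE schedule `prm` with `δL_j ≤ 0` for all `j`, there is a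
height `j₁` from which on NO density is a member: `¬ MemAtHeight F ℰp j (prm j) r` for all `j ≥ j₁` and all `r`.  (`Witness.cLF_card_plaq_le`
on the witness run `K ≥ j` at level `K − j` with `Ū^{K−j}(1) = 1` (`iter_blockAvg_one`, `expMeanLogSU_E_one`), `#Plaq = 3·#Site`
(`card_plaq_three`), and `cLF_j ≥ ¼p(g_j)² ≥ b₀²(log L)²j²∕16` against `Ccov_j ≤ C₀θ_j² ≤ C₀Θ²`, `cE_j, c5_j ≤ C₀`, `slack_j ≤ S`.)
[cite: Balaban1985UV3, (7) p.257, (47) p.267, (65)-(71) p.273] -/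
theorem not_memAtHeight_of_δL_nonpos {γ b₀ p₀ : ℝ} (hγ : 0 < γ) (hγ1 : γ ≤ 1) (hb₀ : 0 < b₀) (hp₀ : 1 ≤ p₀)
    {prm : ℕ → ClassParams} (hprm : AdmissibleClassParams F γ b₀ p₀ prm) (hδL : ∀ j, (prm j).δL ≤ 0) :
    ∃ j₁ : ℕ, ∀ j, j₁ ≤ j → ∀ r : GaugeField (F.P j) 0 ↥(Matrix.specialUnitaryGroup (Fin 2) ℂ) → ℝ,
      ¬ MemAtHeight F ℰp j (prm j) r := by
  -- constants of the schedule
  obtain ⟨Cc, hCc⟩ := hprm.cover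
  obtain ⟨Ce, hCe⟩ := hprm.vacuum
  obtain ⟨C5, hC5⟩ := hprm.stability
  obtain ⟨S, hS⟩ := hprm.slack_le_const
  have hL1 : (1 : ℝ) < F.L := by exact_mod_cast F.hL.2
  have hL0 : (0 : ℝ) < F.L := one_pos.trans hL1
  set ℓ : ℝ := Real.log F.L with hℓ
  have hℓ0 : 0 < ℓ := Real.log_pos hL1
  -- uniform bound on the thresholds
  set Θ : ℝ := b₀ * ((2 * p₀) ^ p₀ * Real.exp (1 / 2 - p₀)) * Real.sqrt (Real.sqrt γ) with hΘ
  have hθΘ : ∀ j, θBal F.L γ b₀ p₀ j ≤ Θ := fun j =>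
    T3Thresholds.θBal_le_const_mul_rpow (L := F.L) F.hL.2.le hγ hγ1 hb₀.le (one_pos.trans_le hp₀) j
  have hθ0 : ∀ j, 0 ≤ θBal F.L γ b₀ p₀ j := fun j =>
    (T3MinimiserStabilityReduction.θBal_pos F.hL.2.le hγ hγ1 hb₀ p₀ j).le
  -- the bound `M` on `(Ccov + cE + c5) + slack⁺`
  set M : ℝ := max Cc 0 * Θ ^ 2 + max Ce 0 + max C5 0 + max S 0 with hM
  have hM0 : 0 ≤ M := by positivity
  -- choose `j₁` with `3·b₀²ℓ²j₁²/16 > M`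
  obtain ⟨j₁, hj₁⟩ := exists_nat_gt (16 * M / (3 * (b₀ ^ 2 * ℓ ^ 2)) + 1)
  refine ⟨j₁, fun j hj r hmem => ?_⟩
  obtain ⟨K, hK, ⟨W⟩⟩ := hmem
  -- the generic obstruction on run `K`, level `K - j`
  have hk1 : Averaging.iter (fun i => BlockAveraging.blockAvg (P := F.P K) (j := i) ℰp) (K - j)
      (1 : GaugeField (F.P K) 0 ↥(Matrix.specialUnitaryGroup (Fin 2) ℂ)) = 1 :=
    iter_blockAvg_one ℰp T3DescentFibreTower.expMeanLogSU_E_one (K - j)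
  have hobs := Witness.cLF_card_plaq_le W (hprm.delta_pos hγ hγ1 hb₀ j) (hprm.deltaReg_pos j) (hprm.beta_pos hγ j).le (hδL j) hk1
  rw [B10Eq41TorusHistories.card_plaq_three rfl] at hobs
  -- sizes
  set n : ℝ := (Fintype.card (Site (F.P K) (K - j)) : ℝ) with hn
  have hn1 : (1 : ℝ) ≤ n := by
    rw [hn]; exact_mod_cast Fintype.card_pos (α := Site (F.P K) (K - j))
  push_cast at hobs
  -- bounds on the constants at height `j`
  have hCcov : (prm j).Ccov ≤ max Cc 0 * Θ ^ 2 :=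
    (hCc j).trans ((mul_le_mul_of_nonneg_right (le_max_left _ _) (sq_nonneg _)).trans
      (mul_le_mul_of_nonneg_left (pow_le_pow_left₀ (hθ0 j) (hθΘ j) 2) (le_max_right _ _)))
  have hcE : (prm j).cE ≤ max Ce 0 := (hCe j).trans (le_max_left _ _)
  have hc5 : (prm j).c5 ≤ max C5 0 := (hC5 j).trans (le_max_left _ _)
  have hsl : (prm j).slack ≤ max S 0 := (hS j).trans (le_max_left _ _)
  have hsum : ((prm j).Ccov + (prm j).cE + (prm j).c5) * n + (prm j).slack ≤ M * n := by
    have h1 : max S 0 ≤ max S 0 * n := le_mul_of_one_le_right (le_max_right _ _) hn1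
    have h2 := mul_le_mul_of_nonneg_right (add_le_add (add_le_add hCcov hcE) hc5) (by linarith : (0 : ℝ) ≤ n)
    have h3 : M * n = (max Cc 0 * Θ ^ 2 + max Ce 0 + max C5 0) * n + max S 0 * n := by rw [hM]; ring
    rw [h3]
    linarith
  -- the large-field exponent at height `j`
  have hcLF : b₀ ^ 2 * ℓ ^ 2 * (j : ℝ) ^ 2 / 16 ≤ (prm j).cLF := by
    refine le_trans ?_ (hprm.largeField j)
    -- `p(g_j) ≥ b₀ · (j ℓ / 2)`
    set x : ℝ := γ * ((F.L : ℝ)⁻¹) ^ j with hx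
    have hx0 : 0 < x := by positivity
    have hlogg : Real.log (Real.sqrt x)⁻¹ = (j * ℓ - Real.log γ) / 2 := by
      rw [Real.log_inv, Real.log_sqrt hx0.le, hx, Real.log_mul hγ.ne' (pow_ne_zero _ (inv_ne_zero hL0.ne')),
        Real.log_pow, Real.log_inv]
      ring
    have hlogγ : Real.log γ ≤ 0 := Real.log_nonpos hγ.le hγ1
    set u : ℝ := 1 + Real.log (Real.sqrt x)⁻¹ with hu
    have hu1 : 1 ≤ u := by
      rw [hu, hlogg]; have : 0 ≤ (j : ℝ) * ℓ := by positivity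
      linarith
    have huK : (j : ℝ) * ℓ / 2 ≤ u := by rw [hu, hlogg]; linarith
    have hpF_ge : b₀ * ((j : ℝ) * ℓ / 2) ≤ B10.pFun b₀ p₀ (Real.sqrt x) := by
      show b₀ * ((j : ℝ) * ℓ / 2) ≤ b₀ * u ^ p₀
      calc b₀ * ((j : ℝ) * ℓ / 2) ≤ b₀ * u := by gcongr
        _ ≤ b₀ * u ^ p₀ := by gcongr; exact Real.self_le_rpow_of_one_le hu1 hp₀
    have hsq : (b₀ * ((j : ℝ) * ℓ / 2)) ^ 2 ≤ B10.pFun b₀ p₀ (Real.sqrt x) ^ 2 :=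
      pow_le_pow_left₀ (by positivity) hpF_ge 2
    have : b₀ ^ 2 * ℓ ^ 2 * (j : ℝ) ^ 2 / 16 = (b₀ * ((j : ℝ) * ℓ / 2)) ^ 2 / 4 := by ring
    rw [this]
    linarith
  -- `j ≥ j₁` makes `3·cLF > M`
  have hj' : 16 * M / (3 * (b₀ ^ 2 * ℓ ^ 2)) + 1 < (j : ℝ) := hj₁.trans_le (by exact_mod_cast hj)
  have hbl : 0 < 3 * (b₀ ^ 2 * ℓ ^ 2) := by positivity
  have hj1 : (1 : ℝ) ≤ j := by
    have : 0 ≤ 16 * M / (3 * (b₀ ^ 2 * ℓ ^ 2)) := by positivity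
    linarith
  have hMlt : M < 3 * (b₀ ^ 2 * ℓ ^ 2 * (j : ℝ) ^ 2 / 16) := by
    have h1 : 16 * M < 3 * (b₀ ^ 2 * ℓ ^ 2) * (j : ℝ) := by
      have := (div_lt_iff₀ hbl).mp (by linarith : 16 * M / (3 * (b₀ ^ 2 * ℓ ^ 2)) < (j : ℝ))
      linarith
    have h2 : (j : ℝ) ≤ (j : ℝ) ^ 2 := by rw [sq]; exact le_mul_of_one_le_right (by linarith) hj1
    have h3 := mul_le_mul_of_nonneg_left h2 hbl.le
    linarith
  -- contradiction
  have hfin : (prm j).cLF * (3 * n) ≤ M * n := by linarith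
  have hlow : 3 * (b₀ ^ 2 * ℓ ^ 2 * (j : ℝ) ^ 2 / 16) * n ≤ (prm j).cLF * (3 * n) := by
    have := mul_le_mul_of_nonneg_right hcLF (by linarith : (0 : ℝ) ≤ 3 * n)
    linarith
  have hstrict : M * n < 3 * (b₀ ^ 2 * ℓ ^ 2 * (j : ℝ) ^ 2 / 16) * n :=
    mul_lt_mul_of_pos_right hMlt (by linarith)
  linarith

/-- **SUCH A SCHEDULE EXISTS**: the printed schedule with the large threshold set to `0` is admissible (`largeThreshold` only asks
`δL_j ≤ 2θ_j`). [cite: Balaban1985UV3, (67) p.273] -/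
theorem exists_admissible_δL_zero (γ b₀ p₀ : ℝ) (hγ : 0 < γ) (hγ1 : γ ≤ 1) (hb₀ : 0 < b₀) :
    ∃ prm : ℕ → ClassParams, AdmissibleClassParams F γ b₀ p₀ prm ∧ ∀ j, (prm j).δL = 0 := by
  have h := printedSchedule_admissible F γ b₀ p₀ one_pos 0 0 one_pos
  refine ⟨fun j => { printedSchedule F γ b₀ p₀ 1 0 0 1 j with δL := 0 }, ?_, fun j => rfl⟩
  exact { window := h.window, regular := h.regular,
          largeThreshold := fun j => by
            show (0 : ℝ) ≤ 2 * θBal F.L γ b₀ p₀ j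
            exact mul_nonneg zero_le_two (T3MinimiserStabilityReduction.θBal_pos F.hL.2.le hγ hγ1 hb₀ p₀ j).le,
          beta := h.beta, decay := h.decay, diam := h.diam, cover := h.cover, vacuum := h.vacuum, slack := h.slack,
          largeField := h.largeField, stability := h.stability }

/-- **ADMISSIBILITY DOES NOT INHABIT THE CLASS** (`0 < γ ≤ 1`, `0 < b₀`, `1 ≤ p₀`): there is an ADMISSIBLE schedule `prm` and a height `j₁`
such that Bałaban's class `MemAtHeight F ℰp j (prm j)` is EMPTY for every `j ≥ j₁` — in particular the tower hypotheses of
`BackwardStabilityAdmFR` (which ask `∃ κ, MemAtHeight … (prm j) (exp κ · ρ_j)` for all large `j`) are unsatisfiable over this schedule, and the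
deliverer `ClassLimitTrajectoriesAdmFR` can never produce it; contrast `AdmFRFrameInhabited.admFR_frame_inhabited` (printed schedule:
inhabited at every height). [cite: Balaban1985UV3, (7) p.257, (47) p.267, (65)-(71) p.273] -/
theorem exists_admissible_emptyClass (γ b₀ p₀ : ℝ) (hγ : 0 < γ) (hγ1 : γ ≤ 1) (hb₀ : 0 < b₀) (hp₀ : 1 ≤ p₀) :
    ∃ prm : ℕ → ClassParams, AdmissibleClassParams F γ b₀ p₀ prm ∧ ∃ j₁ : ℕ, ∀ j, j₁ ≤ j →
      ∀ r : GaugeField (F.P j) 0 ↥(Matrix.specialUnitaryGroup (Fin 2) ℂ) → ℝ, ¬ MemAtHeight F ℰp j (prm j) r := by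
  obtain ⟨prm, hprm, hδL⟩ := exists_admissible_δL_zero F γ b₀ p₀ hγ hγ1 hb₀
  exact ⟨prm, hprm, not_memAtHeight_of_δL_nonpos F hγ hγ1 hb₀ hp₀ hprm fun j => (hδL j).le⟩

end Height

end Summit.QuantumFields.YangMills.Theorems.AdmFRFrameEmptyClass
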